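import Summits.QuantumFields.YangMills.Theorems.SmallCircleAnchorAnchorGapDopNoBranching
import Summits.QuantumFields.YangMills.Theorems.SmallCircleAnchorAnchorGapCovDecPtFactorization
import HarnessLib

/-!
# Crux `AnchorGap` (stmt-QuantumFields-11141), line `registered` — the ANALYTIC HALF of GBND: the
# per-script activity bound `|E(cov X σ_s(t))(D^s Π_{b∈X} G_b)| ≤ A^{|X|} · Π_{ℓ∈lines(s)} (½B² Σ_{x,y∈ℓ} |C_xy|)`
# from per-factor derivative tables `‖DⁿG_b‖ ≤ A·Bⁿ` (part 2: the induction on the lines)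

Continuation of `SmallCircleAnchorAnchorGapDopNoBranching.lean`.  For atom-local smooth factors `F_b`
with a derivative table `‖DⁿF_b(φ)‖ ≤ S_b(n)` and a list `L` of lines between atoms of `X`,
`|(L.foldl Dop (Π_{b∈X} F_b))(φ)| ≤ Π_{ℓ∈L} (½ Σ_{x,y : {blk x,blk y} = ℓ, blk x ≠ blk y} |C_xy|) · Π_{b∈X} S_b(deg_L b)`
(`deg_L b` = number of lines of `L` through `b`): induction on `L` generalising the family and its
table — one step is §1's no-branching expansion, §2's linearity, and the table shift
`S_b(n) ↦ S_b(n + 𝟙[b ∈ ℓ])` (✓`PolyGrowth.norm_iteratedFDeriv_partial_le`).  With geometric tables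
`S_b(n) = A·Bⁿ` this is GBND's hypothesis shape `M · (s.lines.map y).prod`, `M = A^{|X|}`,
`y ℓ = ½B² Σ|C_xy|` — pointwise in `φ`, hence for the normalised Gaussian expectation at every
decoupled interpolation point (probability expectation of a bounded function; positive definiteness
by ✓`DecPt.posDef_cov_decPt`, p792320).

* §3 `contDiff_update₂`, `local_update₂`, `table_update₂`, ★`abs_foldl_dop_prod_le`;
* §4 `not_isDiag_of_mem_lines` (lines of a VALID script join distinct atoms),
  ★`abs_foldl_dop_prod_le_geometric`;
* §5 `abs_gaussExpect_le_of_abs_le` (`|E_{Cv}(H)| ≤ K` when `|H| ≤ K`), ★★`abs_gaussExpect_foldl_dop_prod_le`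
  — GBND's hypothesis `h` for GREP's data with geometric tables, VERBATIM shape
  (`E`, `cov`, `Dop` texts inlined; any root, `univ.image s.y = X`).

[folklore]; no definition, no named fact.
-/

set_option autoImplicit false

namespace Summit.QuantumFields.YangMills.Theorems.AnchorGap.ActBound

open Finset MeasureTheory MvPolynomial Literature.Probability.LatticeModels
  Literature.Probability.LatticeModels.BattleFederbush Literature.MeasureTheory.Integral
open scoped ContDiff Matrix

variable {ι : Type} [Fintype ι] [DecidableEq ι] {β : Type} [DecidableEq β]

/-! ### §3 The per-script bound from per-factor derivative tables -/

/-- Smoothness of a product family member after the `(x,y)`-update. [folklore] -/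
theorem contDiff_update₂ (blk : ι → β) {F : β → (ι → ℝ) → ℝ} (hF : ∀ b, ContDiff ℝ (⊤ : ℕ∞) (F b))
    (x y : ι) (b : β) :
    ContDiff ℝ (⊤ : ℕ∞) (fun φ : ι → ℝ => if b = blk x then fderiv ℝ (F b) φ (Pi.single x 1)
      else if b = blk y then fderiv ℝ (F b) φ (Pi.single y 1) else F b φ) := by
  by_cases hbx : b = blk x
  · simp only [if_pos hbx]; exact PolyGrowth.contDiff_partial (hF b) _
  · by_cases hby : b = blk y
    · simp only [if_neg hbx, if_pos hby]; exact PolyGrowth.contDiff_partial (hF b) _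
    · simp only [if_neg hbx, if_neg hby]; exact hF b

/-- Atom-locality of a product family member after the `(x,y)`-update. [folklore] -/
theorem local_update₂ (blk : ι → β) {F : β → (ι → ℝ) → ℝ} (hF : ∀ b, ContDiff ℝ (⊤ : ℕ∞) (F b))
    (hFl : ∀ (b : β) (φ ψ : ι → ℝ), (∀ i : ι, blk i = b → φ i = ψ i) → F b φ = F b ψ)
    (x y : ι) :
    ∀ (b : β) (φ ψ : ι → ℝ), (∀ i : ι, blk i = b → φ i = ψ i) →
      (if b = blk x then fderiv ℝ (F b) φ (Pi.single x 1)
        else if b = blk y then fderiv ℝ (F b) φ (Pi.single y 1) else F b φ)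
      = (if b = blk x then fderiv ℝ (F b) ψ (Pi.single x 1)
        else if b = blk y then fderiv ℝ (F b) ψ (Pi.single y 1) else F b ψ) := by
  intro b φ ψ h
  have hFd : ∀ b, Differentiable ℝ (F b) := fun b => (hF b).differentiable (by simp)
  by_cases hbx : b = blk x
  · rw [if_pos hbx, if_pos hbx]
    exact DopLocal.seesOnly_fderiv_apply (fun i => blk i = b) (hFd b) (hFl b) _ φ ψ h
  · by_cases hby : b = blk y
    · rw [if_neg hbx, if_pos hby, if_neg hbx, if_pos hby]
      exact DopLocal.seesOnly_fderiv_apply (fun i => blk i = b) (hFd b) (hFl b) _ φ ψ h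
    · rw [if_neg hbx, if_neg hby, if_neg hbx, if_neg hby]; exact hFl b φ ψ h

/-- Table shift: after the `(x,y)`-update for a pair of the line `ℓ`, the member `b` obeys the table
`n ↦ S b (n + 𝟙[b ∈ ℓ])` (✓`PolyGrowth.norm_iteratedFDeriv_partial_le`, `‖e_x‖ ≤ 1`). [folklore] -/
theorem table_update₂ (blk : ι → β) {F : β → (ι → ℝ) → ℝ} (hF : ∀ b, ContDiff ℝ (⊤ : ℕ∞) (F b))
    {S : β → ℕ → ℝ} (hS : ∀ (b : β) (n : ℕ) (φ : ι → ℝ), ‖iteratedFDeriv ℝ n (F b) φ‖ ≤ S b n)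
    (ℓ : Sym2 β) (x y : ι) (hc : s(blk x, blk y) = ℓ ∧ blk x ≠ blk y) :
    ∀ (b : β) (n : ℕ) (φ : ι → ℝ),
      ‖iteratedFDeriv ℝ n (fun φ : ι → ℝ => if b = blk x then fderiv ℝ (F b) φ (Pi.single x 1)
        else if b = blk y then fderiv ℝ (F b) φ (Pi.single y 1) else F b φ) φ‖
      ≤ S b (n + if b ∈ ℓ then 1 else 0) := by
  intro b n φ
  have hSnn : ∀ b n, 0 ≤ S b n := fun b n => (norm_nonneg _).trans (hS b n φ)
  have hmem : b ∈ ℓ ↔ b = blk x ∨ b = blk y := by rw [← hc.1]; exact Sym2.mem_iff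
  by_cases hbx : b = blk x
  · rw [if_pos (hmem.2 (Or.inl hbx))]
    subst hbx
    simp only [if_true]
    calc ‖iteratedFDeriv ℝ n (fun φ => fderiv ℝ (F (blk x)) φ (Pi.single x 1)) φ‖
        ≤ ‖(Pi.single x (1 : ℝ) : ι → ℝ)‖ * ‖iteratedFDeriv ℝ (n + 1) (F (blk x)) φ‖ :=
          PolyGrowth.norm_iteratedFDeriv_partial_le (hF _) _ n φ
      _ ≤ 1 * S (blk x) (n + 1) :=
          mul_le_mul (PolyGrowth.norm_single_le_one x) (hS _ _ φ) (norm_nonneg _) zero_le_one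
      _ = S (blk x) (n + 1) := one_mul _
  · by_cases hby : b = blk y
    · rw [if_pos (hmem.2 (Or.inr hby))]
      subst hby
      simp only [if_neg hbx, if_true]
      calc ‖iteratedFDeriv ℝ n (fun φ => fderiv ℝ (F (blk y)) φ (Pi.single y 1)) φ‖
          ≤ ‖(Pi.single y (1 : ℝ) : ι → ℝ)‖ * ‖iteratedFDeriv ℝ (n + 1) (F (blk y)) φ‖ :=
            PolyGrowth.norm_iteratedFDeriv_partial_le (hF _) _ n φ
        _ ≤ 1 * S (blk y) (n + 1) :=
            mul_le_mul (PolyGrowth.norm_single_le_one y) (hS _ _ φ) (norm_nonneg _) zero_le_one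
        _ = S (blk y) (n + 1) := one_mul _
    · simp only [if_neg hbx, if_neg hby]
      rw [if_neg (fun h => (hmem.1 h).elim hbx hby), add_zero]
      exact hS b n φ

/-- **The per-script activity bound from per-factor derivative tables (analytic half of GBND).**
For atom-local smooth factors `F_b` with `‖DⁿF_b(φ)‖ ≤ S_b(n)` and a list `L` of lines between atoms
of `X`:
`|(L.foldl Dop (Π_{b∈X} F_b))(φ)| ≤ Π_{ℓ∈L} (½ Σ_{x,y : {blk x, blk y} = ℓ, blk x ≠ blk y} |C_xy|) · Π_{b∈X} S_b(deg_L b)`,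
`deg_L b = #{ℓ ∈ L | b ∈ ℓ}` (with multiplicity). [folklore] -/
theorem abs_foldl_dop_prod_le (blk : ι → β) (C : Matrix ι ι ℝ)
    (X : Finset β) :
    ∀ (L : List (Sym2 β)), (∀ ℓ ∈ L, ∀ a ∈ ℓ, a ∈ X) →
      ∀ (F : β → (ι → ℝ) → ℝ), (∀ b, ContDiff ℝ (⊤ : ℕ∞) (F b)) →
        (∀ (b : β) (φ ψ : ι → ℝ), (∀ i : ι, blk i = b → φ i = ψ i) → F b φ = F b ψ) →
        ∀ (S : β → ℕ → ℝ), (∀ (b : β) (n : ℕ) (φ : ι → ℝ), ‖iteratedFDeriv ℝ n (F b) φ‖ ≤ S b n) →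
        ∀ φ : ι → ℝ,
          |(L.foldl (fun (H : (ι → ℝ) → ℝ) (ℓ : Sym2 β) => fun φ : ι → ℝ =>
              (1 / 2 : ℝ) * ∑ x : ι, ∑ y : ι, if s(blk x, blk y) = ℓ ∧ blk x ≠ blk y then
                C x y * iteratedFDeriv ℝ 2 H φ ![Pi.single x 1, Pi.single y 1] else 0)
              (fun φ : ι → ℝ => ∏ b ∈ X, F b φ)) φ|
          ≤ (L.map fun ℓ => (1 / 2 : ℝ) * ∑ x : ι, ∑ y : ι,
                if s(blk x, blk y) = ℓ ∧ blk x ≠ blk y then |C x y| else 0).prod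
            * ∏ b ∈ X, S b ((L.map fun ℓ => if b ∈ ℓ then 1 else 0).sum) := by
  classical
  intro L
  induction L with
  | nil =>
    intro _ F _ _ S hS φ
    simp only [List.foldl_nil, List.map_nil, List.prod_nil, List.sum_nil, one_mul, Finset.abs_prod]
    exact Finset.prod_le_prod (fun b _ => abs_nonneg _) fun b _ => by
      rw [PolyGrowth.abs_le_of_norm_iteratedFDeriv_zero]; exact hS b 0 φ
  | cons ℓ L ih =>
    intro hL F hF hFl S hS φ
    have hℓ : ∀ a ∈ ℓ, a ∈ X := hL ℓ (by simp)
    have hL' : ∀ ℓ' ∈ L, ∀ a ∈ ℓ', a ∈ X := fun ℓ' h => hL ℓ' (List.mem_cons_of_mem _ h)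
    have hSnn : ∀ b n, 0 ≤ S b n := fun b n => (norm_nonneg _).trans (hS b n φ)
    simp only [List.foldl_cons, List.map_cons, List.prod_cons, List.sum_cons]
    -- the first step as a finite sum over coordinate pairs
    have hstep : (fun φ : ι → ℝ => (1 / 2 : ℝ) * ∑ x : ι, ∑ y : ι,
        if s(blk x, blk y) = ℓ ∧ blk x ≠ blk y then
          C x y * iteratedFDeriv ℝ 2 (fun φ : ι → ℝ => ∏ b ∈ X, F b φ) φ
            ![Pi.single x 1, Pi.single y 1] else 0)
        = fun φ => ∑ p ∈ (Finset.univ : Finset (ι × ι)),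
          ((1 / 2 : ℝ) * if s(blk p.1, blk p.2) = ℓ ∧ blk p.1 ≠ blk p.2 then C p.1 p.2 else 0)
          * ∏ b ∈ X, (if b = blk p.1 then fderiv ℝ (F b) φ (Pi.single p.1 1)
              else if b = blk p.2 then fderiv ℝ (F b) φ (Pi.single p.2 1) else F b φ) := by
      funext φ
      rw [dop_prod_eq_sum blk C X ℓ hℓ hF hFl φ, Fintype.sum_prod_type]
    rw [hstep, foldl_dop_lincomb blk C (Finset.univ : Finset (ι × ι)) L
      (fun p : ι × ι => (1 / 2 : ℝ) * if s(blk p.1, blk p.2) = ℓ ∧ blk p.1 ≠ blk p.2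
        then C p.1 p.2 else 0)
      (fun (p : ι × ι) (φ : ι → ℝ) => ∏ b ∈ X, (if b = blk p.1 then fderiv ℝ (F b) φ (Pi.single p.1 1)
        else if b = blk p.2 then fderiv ℝ (F b) φ (Pi.single p.2 1) else F b φ))
      (fun p => contDiff_prod fun b _ => contDiff_update₂ blk hF p.1 p.2 b)]
    -- termwise bound by the induction hypothesis with the shifted table
    refine (Finset.abs_sum_le_sum_abs _ _).trans ?_
    have hterm : ∀ p : ι × ι,
        |((1 / 2 : ℝ) * if s(blk p.1, blk p.2) = ℓ ∧ blk p.1 ≠ blk p.2 then C p.1 p.2 else 0)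
          * L.foldl (fun (H : (ι → ℝ) → ℝ) (ℓ : Sym2 β) => fun φ : ι → ℝ =>
              (1 / 2 : ℝ) * ∑ x : ι, ∑ y : ι, if s(blk x, blk y) = ℓ ∧ blk x ≠ blk y then
                C x y * iteratedFDeriv ℝ 2 H φ ![Pi.single x 1, Pi.single y 1] else 0)
            (fun φ => ∏ b ∈ X, (if b = blk p.1 then fderiv ℝ (F b) φ (Pi.single p.1 1)
              else if b = blk p.2 then fderiv ℝ (F b) φ (Pi.single p.2 1) else F b φ)) φ|
        ≤ ((1 / 2 : ℝ) * if s(blk p.1, blk p.2) = ℓ ∧ blk p.1 ≠ blk p.2 then |C p.1 p.2| else 0)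
          * ((L.map fun ℓ => (1 / 2 : ℝ) * ∑ x : ι, ∑ y : ι,
              if s(blk x, blk y) = ℓ ∧ blk x ≠ blk y then |C x y| else 0).prod
            * ∏ b ∈ X, S b ((if b ∈ ℓ then 1 else 0)
              + (L.map fun ℓ => if b ∈ ℓ then 1 else 0).sum)) := by
      intro p
      by_cases hc : s(blk p.1, blk p.2) = ℓ ∧ blk p.1 ≠ blk p.2
      · rw [if_pos hc, if_pos hc, abs_mul, abs_mul, abs_of_pos (by norm_num : (0 : ℝ) < 1 / 2)]
        refine mul_le_mul_of_nonneg_left ?_ (by positivity)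
        have h := ih hL' _ (fun b => contDiff_update₂ blk hF p.1 p.2 b)
          (local_update₂ blk hF hFl p.1 p.2) (fun b n => S b (n + if b ∈ ℓ then 1 else 0))
          (table_update₂ blk hF hS ℓ p.1 p.2 hc) φ
        refine h.trans (le_of_eq ?_)
        congr 1
        exact Finset.prod_congr rfl fun b _ => by rw [add_comm]
      · rw [if_neg hc, if_neg hc]; simp
    refine (Finset.sum_le_sum fun p _ => hterm p).trans (le_of_eq ?_)
    rw [← Finset.sum_mul, Fintype.sum_prod_type]
    simp only [Finset.mul_sum]
    ring

/-! ### §4 Geometric tables -/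

omit [Fintype ι] [DecidableEq ι] [DecidableEq β] in
/-- **The lines of a VALID script join distinct atoms** (each new point differs from its parent).
[folklore] -/
theorem not_isDiag_of_mem_lines {r : β} : {k : ℕ} → (s : Script r k) → s.Valid →
    ∀ ℓ ∈ s.lines, ¬ ℓ.IsDiag
  | _, Script.nil, _ => by simp [Script.lines]
  | _, Script.snoc s i z, hs => by
    intro ℓ hℓ
    rw [Script.valid_snoc_iff] at hs
    simp only [Script.lines, List.mem_append, List.mem_singleton] at hℓ
    rcases hℓ with hℓ | rfl
    · exact not_isDiag_of_mem_lines s hs.1 ℓ hℓ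
    · rw [Sym2.mk_isDiag_iff]; exact hs.2 i


/-- **Geometric derivative tables**: with `‖DⁿF_b‖ ≤ A·Bⁿ` and lines between DISTINCT atoms
of `X`, `|(L.foldl Dop (Π_{b∈X} F_b))(φ)| ≤ A^{|X|} · Π_{ℓ∈L} (½ B² Σ_{x,y∈ℓ} |C_xy|)` — GBND's
hypothesis shape `M · (lines.map y).prod` with `M = A^{|X|}`, `y ℓ = ½B²Σ|C_xy|`. [folklore] -/
theorem abs_foldl_dop_prod_le_geometric (blk : ι → β) (C : Matrix ι ι ℝ)
    (X : Finset β) (L : List (Sym2 β)) (hL : ∀ ℓ ∈ L, ∀ a ∈ ℓ, a ∈ X) (hLd : ∀ ℓ ∈ L, ¬ ℓ.IsDiag)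
    (F : β → (ι → ℝ) → ℝ) (hF : ∀ b, ContDiff ℝ (⊤ : ℕ∞) (F b))
    (hFl : ∀ (b : β) (φ ψ : ι → ℝ), (∀ i : ι, blk i = b → φ i = ψ i) → F b φ = F b ψ)
    {A B : ℝ}
    (hS : ∀ (b : β) (n : ℕ) (φ : ι → ℝ), ‖iteratedFDeriv ℝ n (F b) φ‖ ≤ A * B ^ n) (φ : ι → ℝ) :
    |(L.foldl (fun (H : (ι → ℝ) → ℝ) (ℓ : Sym2 β) => fun φ : ι → ℝ =>
        (1 / 2 : ℝ) * ∑ x : ι, ∑ y : ι, if s(blk x, blk y) = ℓ ∧ blk x ≠ blk y then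
          C x y * iteratedFDeriv ℝ 2 H φ ![Pi.single x 1, Pi.single y 1] else 0)
        (fun φ : ι → ℝ => ∏ b ∈ X, F b φ)) φ|
      ≤ A ^ X.card * (L.map fun ℓ => (1 / 2 : ℝ) * B ^ 2 * ∑ x : ι, ∑ y : ι,
          if s(blk x, blk y) = ℓ ∧ blk x ≠ blk y then |C x y| else 0).prod := by
  classical
  have h := abs_foldl_dop_prod_le blk C X L hL F hF hFl (fun _ n => A * B ^ n) hS φ
  refine h.trans (le_of_eq ?_)
  -- `Π_b A·B^{deg b} = A^{|X|} · B^{Σ deg} = A^{|X|} · B^{2|L|}` and regroup `B²` per line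
  rw [Finset.prod_mul_distrib, Finset.prod_const, Finset.prod_pow_eq_pow_sum]
  -- `Σ_{b∈X} deg_L b = 2·|L|` (each line has exactly two atoms, both in `X`)
  have hdeg : ∀ (L : List (Sym2 β)), (∀ ℓ ∈ L, ∀ a ∈ ℓ, a ∈ X) → (∀ ℓ ∈ L, ¬ ℓ.IsDiag) →
      ∑ b ∈ X, (L.map fun ℓ => if b ∈ ℓ then 1 else 0).sum = 2 * L.length := by
    intro L
    induction L with
    | nil => intro _ _; simp
    | cons ℓ L ih =>
      intro hL hLd
      simp only [List.map_cons, List.sum_cons, List.length_cons, Finset.sum_add_distrib]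
      rw [ih (fun ℓ' h => hL ℓ' (List.mem_cons_of_mem _ h))
        (fun ℓ' h => hLd ℓ' (List.mem_cons_of_mem _ h))]
      have hℓ := hL ℓ (by simp)
      have hℓd := hLd ℓ (by simp)
      have h2 : ∑ b ∈ X, (if b ∈ ℓ then 1 else 0) = 2 := by
        induction ℓ using Sym2.ind with
        | h a a' =>
          have hne : a ≠ a' := fun h => hℓd (by rw [h]; exact Sym2.mk_isDiag_iff.2 rfl)
          rw [Finset.sum_ite, Finset.sum_const_zero, add_zero, Finset.sum_const, smul_eq_mul, mul_one]
          have : X.filter (fun b => b ∈ s(a, a')) = {a, a'} := by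
            ext b
            simp only [Finset.mem_filter, Sym2.mem_iff, Finset.mem_insert, Finset.mem_singleton]
            constructor
            · exact fun h => h.2
            · rintro (rfl | rfl)
              · exact ⟨hℓ _ (Sym2.mem_mk_left _ _), Or.inl rfl⟩
              · exact ⟨hℓ _ (Sym2.mem_mk_right _ _), Or.inr rfl⟩
          rw [this, Finset.card_pair hne]
      omega
  rw [hdeg L hL hLd]
  -- regroup: `Π_ℓ (½ B² Σ) = B^{2|L|} · Π_ℓ (½ Σ)`
  have hprod : ∀ (L : List (Sym2 β)),
      (L.map fun ℓ => (1 / 2 : ℝ) * B ^ 2 * ∑ x : ι, ∑ y : ι,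
          if s(blk x, blk y) = ℓ ∧ blk x ≠ blk y then |C x y| else 0).prod
        = B ^ (2 * L.length) * (L.map fun ℓ => (1 / 2 : ℝ) * ∑ x : ι, ∑ y : ι,
          if s(blk x, blk y) = ℓ ∧ blk x ≠ blk y then |C x y| else 0).prod := by
    intro L
    induction L with
    | nil => simp
    | cons ℓ L ih =>
      simp only [List.map_cons, List.prod_cons, List.length_cons]
      rw [ih]; ring
  rw [hprod]
  ring

/-! ### §5 The bound for the interpolated Gaussian expectation (GBND's hypothesis shape) -/

omit [DecidableEq β] in
/-- **A normalised Gaussian expectation of a bounded observable is bounded by the same constant**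
(`|H| ≤ K ⇒ |E_{Cv}(H)| ≤ K`; the partition function is positive, ✓`GaussSmooth.gaussInt_partition_pos`).
[folklore] -/
theorem abs_gaussExpect_le_of_abs_le {Cv : ι → ι → ℝ} (hCv : (Matrix.of Cv).PosDef)
    {H : (ι → ℝ) → ℝ} {K : ℝ} (hK : ∀ φ : ι → ℝ, |H φ| ≤ K) :
    |(∫ φ : ι → ℝ, H φ * Real.exp (-(φ ⬝ᵥ ((Matrix.of Cv)⁻¹ *ᵥ φ)) / 2))
        / ∫ φ : ι → ℝ, Real.exp (-(φ ⬝ᵥ ((Matrix.of Cv)⁻¹ *ᵥ φ)) / 2)| ≤ K := by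
  have hZ := GaussSmooth.gaussInt_partition_pos hCv
  have hK0 : 0 ≤ K := (abs_nonneg _).trans (hK 0)
  have hint : Integrable (fun φ : ι → ℝ =>
      K * Real.exp (-(φ ⬝ᵥ ((Matrix.of Cv)⁻¹ *ᵥ φ)) / 2)) := by
    have h1 := integrable_polyGrowth_mul_gaussian ι (Matrix.of Cv)⁻¹ hCv.inv 0 1 (fun _ => 1)
      measurable_const.aestronglyMeasurable (fun φ => by simp)
    simp only [one_mul] at h1
    exact h1.const_mul K
  have hnum : ‖∫ φ : ι → ℝ, H φ * Real.exp (-(φ ⬝ᵥ ((Matrix.of Cv)⁻¹ *ᵥ φ)) / 2)‖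
      ≤ ∫ φ : ι → ℝ, K * Real.exp (-(φ ⬝ᵥ ((Matrix.of Cv)⁻¹ *ᵥ φ)) / 2) := by
    refine norm_integral_le_of_norm_le hint (Filter.Eventually.of_forall fun φ => ?_)
    rw [norm_mul, Real.norm_eq_abs, Real.norm_eq_abs, abs_of_pos (Real.exp_pos _)]
    exact mul_le_mul_of_nonneg_right (hK φ) (Real.exp_pos _).le
  rw [integral_const_mul] at hnum
  rw [abs_div, abs_of_pos hZ, div_le_iff₀ hZ]
  exact (Real.norm_eq_abs _).symm.le.trans hnum

/-- **GBND's hypothesis for GREP's data with geometric derivative tables.** For `C` positive definite,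
atom-local smooth factors `G_b` with `‖DⁿG_b(φ)‖ ≤ A·Bⁿ`, a VALID script `s` whose points are the
atoms of `X`, and a cube parameter `t`:
`|E(cov X σ_s(t))(s.lines.foldl Dop (Π_{b∈X} G_b))| ≤ A^{|X|} · Π_{ℓ∈lines(s)} (½ B² Σ_{x,y∈ℓ} |C_xy|)`
— the `h` of ✓`stub_bbfActivityTreeBound` with `M := A^{|X|}`, `y ℓ := ½B²Σ|C_xy|`, GREP's `E`, `cov`,
`Dop` texts INLINED. [folklore] -/
theorem abs_gaussExpect_foldl_dop_prod_le [Fintype β] (blk : ι → β) (C : Matrix ι ι ℝ)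
    (hC : C.PosDef) (X : Finset β) (G : β → (ι → ℝ) → ℝ) (hG : ∀ b, ContDiff ℝ (⊤ : ℕ∞) (G b))
    (hGl : ∀ (b : β) (φ ψ : ι → ℝ), (∀ i : ι, blk i = b → φ i = ψ i) → G b φ = G b ψ)
    {A B : ℝ} (hS : ∀ (b : β) (n : ℕ) (φ : ι → ℝ), ‖iteratedFDeriv ℝ n (G b) φ‖ ≤ A * B ^ n)
    {r : β} {k : ℕ} (s : Script r k) (hs : s.Valid) (hsX : Finset.univ.image s.y = X)
    {t : β → ℝ} (ht : t ∈ unitCube β) :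
    |(∫ φ : ι → ℝ, (s.lines.foldl (fun (H : (ι → ℝ) → ℝ) (ℓ : Sym2 β) => fun φ : ι → ℝ =>
          (1 / 2 : ℝ) * ∑ x : ι, ∑ y : ι, if s(blk x, blk y) = ℓ ∧ blk x ≠ blk y then
            C x y * iteratedFDeriv ℝ 2 H φ ![Pi.single x 1, Pi.single y 1] else 0)
          (fun φ : ι → ℝ => ∏ b ∈ X, G b φ)) φ
        * Real.exp (-(φ ⬝ᵥ ((Matrix.of fun i j : ι => (if blk i = blk j then 1 else
          if blk i ∈ X ∧ blk j ∈ X then eval t (Script.decPt ℝ s s(blk i, blk j)) else 0) * C i j)⁻¹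
            *ᵥ φ)) / 2))
      / ∫ φ : ι → ℝ, Real.exp (-(φ ⬝ᵥ ((Matrix.of fun i j : ι => (if blk i = blk j then 1 else
          if blk i ∈ X ∧ blk j ∈ X then eval t (Script.decPt ℝ s s(blk i, blk j)) else 0) * C i j)⁻¹
            *ᵥ φ)) / 2)|
      ≤ A ^ X.card * (s.lines.map fun ℓ => (1 / 2 : ℝ) * B ^ 2 * ∑ x : ι, ∑ y : ι,
          if s(blk x, blk y) = ℓ ∧ blk x ≠ blk y then |C x y| else 0).prod :=
  abs_gaussExpect_le_of_abs_le (DecPt.posDef_cov_decPt blk C hC X s hs ht) fun φ =>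
    abs_foldl_dop_prod_le_geometric blk C X s.lines
      (fun ℓ hℓ a ha => hsX ▸ Script.mem_image_of_mem_lines s ℓ hℓ a ha)
      (not_isDiag_of_mem_lines s hs) G hG hGl hS φ

end Summit.QuantumFields.YangMills.Theorems.AnchorGap.ActBound
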